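import Literature.AnabelianGeometry.SemiGraphs.GraphOfAnabelioids

/-!
# (Co)limits in the category `B(𝒢)` of a semi-graph of anabelioids are computed componentwise

Proof-only companion of `GraphOfAnabelioids.lean` ([SemiAnbd] Def. 2.1, pp. 22–23), first half of
the named fact `bOf_galoisCategory` ("one verifies immediately that this category `B(𝒢)` is a
connected anabelioid").  For a semi-graph of anabelioids `𝒢` and an index category `J` such that
the constituent anabelioids `𝒢_v`, `𝒢_e` have (co)limits of shape `J` and the pull-back functors
`b^* : 𝒢_v ⥤ 𝒢_e` preserve them (e.g. every finite `J`: the `b^*` are exact), the category `B(𝒢)`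
of systems `{S_v, T_e, ψ_b : b^* S_v ⥲ T_e}` has (co)limits of shape `J`, computed componentwise
(the gluing isomorphism of the (co)limit is `b^*(lim S_v) ≅ lim b^* S_v ≅ lim T_e`), and the
restriction functors `ρ_v : B(𝒢) ⥤ 𝒢_v`, `ρ_e : B(𝒢) ⥤ 𝒢_e` preserve them
(`hasLimitsOfShape_bObj`, `hasColimitsOfShape_bObj`).

No definitions: the (co)limit (co)cones are built inside the proofs (the statements are the
`Prop`s `HasLimitsOfShape` / `PreservesLimitsOfShape`).
-/

namespace Literature.AnabelianGeometry.SemiGraphs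

open CategoryTheory CategoryTheory.Limits

universe w' w v₁ u₁ u

namespace SemiGraphOfAnabelioids

variable (𝒢 : SemiGraphOfAnabelioids.{v₁, u₁, u})

/-- **Limits in `B(𝒢)` are componentwise** ([SemiAnbd] p. 23, part of "one verifies immediately
that `B(𝒢)` is a connected anabelioid"): if the constituent anabelioids have limits of shape `J`
preserved by the pull-back functors `b^*`, then `B(𝒢)` has limits of shape `J` and the restriction
functors `ρ_v`, `ρ_e` preserve them. [cite: MochizukiSemiAnbd2006, Def. 2.1 p.23] -/
theorem hasLimitsOfShape_bObj {J : Type w} [Category.{w'} J]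
    [∀ v, HasLimitsOfShape J (𝒢.V v)] [∀ e, HasLimitsOfShape J (𝒢.E e)]
    [hP : ∀ (b : 𝒢.graph.Branch) (v : 𝒢.graph.Vertex) (h : 𝒢.graph.abuts b = some v),
      PreservesLimitsOfShape J (𝒢.pull b v h).pullback] :
    HasLimitsOfShape J 𝒢.BObj ∧ (∀ v, PreservesLimitsOfShape J (𝒢.ρ v)) ∧
      ∀ e, PreservesLimitsOfShape J (𝒢.ρE e) := by
  have main : ∀ K : J ⥤ 𝒢.BObj, ∃ (c : Cone K), Nonempty (IsLimit c) ∧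
      (∀ v, Nonempty (IsLimit ((𝒢.ρ v).mapCone c))) ∧
        ∀ e, Nonempty (IsLimit ((𝒢.ρE e).mapCone c)) := by
    intro K
    -- the gluing isomorphisms of the `K j` as natural isomorphisms `(K ⋙ ρ_v) ⋙ b^* ≅ K ⋙ ρ_e`
    let ν : ∀ (b : 𝒢.graph.Branch) (v : 𝒢.graph.Vertex) (h : 𝒢.graph.abuts b = some v),
        (K ⋙ 𝒢.ρ v) ⋙ (𝒢.pull b v h).pullback ≅ K ⋙ 𝒢.ρE (𝒢.graph.edgeOf b) :=
      fun b v h => NatIso.ofComponents (fun j => (K.obj j).ψ b v h)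
        (fun {j j'} f => (K.map f).comm b v h)
    -- the componentwise limit cone
    let pt : 𝒢.BObj :=
      { S := fun v => limit (K ⋙ 𝒢.ρ v)
        T := fun e => limit (K ⋙ 𝒢.ρE e)
        ψ := fun b v h => preservesLimitIso (𝒢.pull b v h).pullback (K ⋙ 𝒢.ρ v) ≪≫
            HasLimit.isoOfNatIso (ν b v h) }
    have hψ : ∀ (b : 𝒢.graph.Branch) (v : 𝒢.graph.Vertex) (h : 𝒢.graph.abuts b = some v) (j : J),
        (pt.ψ b v h).hom ≫ limit.π (K ⋙ 𝒢.ρE (𝒢.graph.edgeOf b)) j =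
          (𝒢.pull b v h).pullback.map (limit.π (K ⋙ 𝒢.ρ v) j) ≫ ((K.obj j).ψ b v h).hom := by
      intro b v h j
      show (preservesLimitIso (𝒢.pull b v h).pullback (K ⋙ 𝒢.ρ v) ≪≫
        HasLimit.isoOfNatIso (ν b v h)).hom ≫ _ = _
      rw [Iso.trans_hom, Category.assoc, HasLimit.isoOfNatIso_hom_π, preservesLimitIso_hom_π_assoc]
      rfl
    let c : Cone K :=
      { pt := pt
        π :=
          { app := fun j =>
              { fS := fun v => limit.π (K ⋙ 𝒢.ρ v) j
                fT := fun e => limit.π (K ⋙ 𝒢.ρE e) j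
                comm := fun b v h => (hψ b v h j).symm }
            naturality := fun j j' f => by
              refine BObj.hom_ext _ _ (funext fun v => ?_) (funext fun e => ?_)
              · show 𝟙 _ ≫ limit.π (K ⋙ 𝒢.ρ v) j' = limit.π (K ⋙ 𝒢.ρ v) j ≫ (K.map f).fS v
                rw [Category.id_comp]
                exact (limit.w (K ⋙ 𝒢.ρ v) f).symm
              · show 𝟙 _ ≫ limit.π (K ⋙ 𝒢.ρE e) j' = limit.π (K ⋙ 𝒢.ρE e) j ≫ (K.map f).fT e
                rw [Category.id_comp]
                exact (limit.w (K ⋙ 𝒢.ρE e) f).symm } }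
    have hc : IsLimit c :=
      { lift := fun s =>
          { fS := fun v => limit.lift (K ⋙ 𝒢.ρ v) ((𝒢.ρ v).mapCone s)
            fT := fun e => limit.lift (K ⋙ 𝒢.ρE e) ((𝒢.ρE e).mapCone s)
            comm := fun b v h => by
              apply limit.hom_ext
              intro j
              -- notation-free chain of equalities (each link elaborated up to definitional
              -- unfolding of `(K ⋙ ρ_v).obj j = (K.obj j).S v`)
              have A1 : ((𝒢.pull b v h).pullback.map (limit.lift (K ⋙ 𝒢.ρ v)
                  ((𝒢.ρ v).mapCone s)) ≫ (pt.ψ b v h).hom) ≫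
                    limit.π (K ⋙ 𝒢.ρE (𝒢.graph.edgeOf b)) j =
                  (𝒢.pull b v h).pullback.map (limit.lift (K ⋙ 𝒢.ρ v) ((𝒢.ρ v).mapCone s)) ≫
                    ((𝒢.pull b v h).pullback.map (limit.π (K ⋙ 𝒢.ρ v) j) ≫
                      ((K.obj j).ψ b v h).hom) :=
                (Category.assoc _ _ _).trans (congrArg _ (hψ b v h j))
              have A2 : (𝒢.pull b v h).pullback.map (limit.lift (K ⋙ 𝒢.ρ v)
                  ((𝒢.ρ v).mapCone s)) ≫ ((𝒢.pull b v h).pullback.map (limit.π (K ⋙ 𝒢.ρ v) j) ≫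
                    ((K.obj j).ψ b v h).hom) =
                  ((𝒢.pull b v h).pullback.map (limit.lift (K ⋙ 𝒢.ρ v) ((𝒢.ρ v).mapCone s)) ≫
                    (𝒢.pull b v h).pullback.map (limit.π (K ⋙ 𝒢.ρ v) j)) ≫
                      ((K.obj j).ψ b v h).hom := (Category.assoc _ _ _).symm
              have A3 : (𝒢.pull b v h).pullback.map (limit.lift (K ⋙ 𝒢.ρ v)
                  ((𝒢.ρ v).mapCone s)) ≫ (𝒢.pull b v h).pullback.map (limit.π (K ⋙ 𝒢.ρ v) j) =
                  (𝒢.pull b v h).pullback.map ((s.π.app j).fS v) := by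
                rw [← Functor.map_comp, limit.lift_π]
                rfl
              have A4 := (s.π.app j).comm b v h
              have A5 : limit.lift (K ⋙ 𝒢.ρE (𝒢.graph.edgeOf b))
                  ((𝒢.ρE (𝒢.graph.edgeOf b)).mapCone s) ≫
                    limit.π (K ⋙ 𝒢.ρE (𝒢.graph.edgeOf b)) j = (s.π.app j).fT (𝒢.graph.edgeOf b) :=
                limit.lift_π _ _
              exact A1.trans (A2.trans ((congrArg (· ≫ ((K.obj j).ψ b v h).hom) A3).trans
                (A4.trans ((congrArg ((s.pt.ψ b v h).hom ≫ ·) A5).symm.trans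
                  (Category.assoc _ _ _).symm)))) }
        fac := fun s j => by
          refine BObj.hom_ext _ _ (funext fun v => ?_) (funext fun e => ?_)
          · exact limit.lift_π _ _
          · exact limit.lift_π _ _
        uniq := fun s m hm => by
          refine BObj.hom_ext _ _ (funext fun v => ?_) (funext fun e => ?_)
          · apply limit.hom_ext
            intro j
            exact (congrArg (fun g => BObj.Hom.fS g v) (hm j)).trans
              (limit.lift_π ((𝒢.ρ v).mapCone s) j).symm
          · apply limit.hom_ext
            intro j
            exact (congrArg (fun g => BObj.Hom.fT g e) (hm j)).trans
              (limit.lift_π ((𝒢.ρE e).mapCone s) j).symm }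
    refine ⟨c, ⟨hc⟩, fun v => ⟨?_⟩, fun e => ⟨?_⟩⟩
    · exact (limit.isLimit (K ⋙ 𝒢.ρ v)).ofIsoLimit
        (Cone.ext (Iso.refl _) (fun j => (Category.id_comp _).symm))
    · exact (limit.isLimit (K ⋙ 𝒢.ρE e)).ofIsoLimit
        (Cone.ext (Iso.refl _) (fun j => (Category.id_comp _).symm))
  refine ⟨⟨fun K => ?_⟩, fun v => ⟨fun {K} => ?_⟩, fun e => ⟨fun {K} => ?_⟩⟩
  · obtain ⟨c, ⟨hc⟩, -, -⟩ := main K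
    exact ⟨c, hc⟩
  · obtain ⟨c, ⟨hc⟩, hv, -⟩ := main K
    exact preservesLimit_of_preserves_limit_cone hc (hv v).some
  · obtain ⟨c, ⟨hc⟩, -, he⟩ := main K
    exact preservesLimit_of_preserves_limit_cone hc (he e).some

/-- **Colimits in `B(𝒢)` are componentwise** ([SemiAnbd] p. 23, part of "one verifies immediately
that `B(𝒢)` is a connected anabelioid"): if the constituent anabelioids have colimits of shape `J`
preserved by the pull-back functors `b^*`, then `B(𝒢)` has colimits of shape `J` and `ρ_v`, `ρ_e`
preserve them. [cite: MochizukiSemiAnbd2006, Def. 2.1 p.23] -/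
theorem hasColimitsOfShape_bObj {J : Type w} [Category.{w'} J]
    [∀ v, HasColimitsOfShape J (𝒢.V v)] [∀ e, HasColimitsOfShape J (𝒢.E e)]
    [hP : ∀ (b : 𝒢.graph.Branch) (v : 𝒢.graph.Vertex) (h : 𝒢.graph.abuts b = some v),
      PreservesColimitsOfShape J (𝒢.pull b v h).pullback] :
    HasColimitsOfShape J 𝒢.BObj ∧ (∀ v, PreservesColimitsOfShape J (𝒢.ρ v)) ∧
      ∀ e, PreservesColimitsOfShape J (𝒢.ρE e) := by
  have main : ∀ K : J ⥤ 𝒢.BObj, ∃ (c : Cocone K), Nonempty (IsColimit c) ∧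
      (∀ v, Nonempty (IsColimit ((𝒢.ρ v).mapCocone c))) ∧
        ∀ e, Nonempty (IsColimit ((𝒢.ρE e).mapCocone c)) := by
    intro K
    let ν : ∀ (b : 𝒢.graph.Branch) (v : 𝒢.graph.Vertex) (h : 𝒢.graph.abuts b = some v),
        (K ⋙ 𝒢.ρ v) ⋙ (𝒢.pull b v h).pullback ≅ K ⋙ 𝒢.ρE (𝒢.graph.edgeOf b) :=
      fun b v h => NatIso.ofComponents (fun j => (K.obj j).ψ b v h)
        (fun {j j'} f => (K.map f).comm b v h)
    let pt : 𝒢.BObj :=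
      { S := fun v => colimit (K ⋙ 𝒢.ρ v)
        T := fun e => colimit (K ⋙ 𝒢.ρE e)
        ψ := fun b v h => (preservesColimitIso (𝒢.pull b v h).pullback (K ⋙ 𝒢.ρ v)) ≪≫
            HasColimit.isoOfNatIso (ν b v h) }
    have hψ : ∀ (b : 𝒢.graph.Branch) (v : 𝒢.graph.Vertex) (h : 𝒢.graph.abuts b = some v) (j : J),
        (𝒢.pull b v h).pullback.map (colimit.ι (K ⋙ 𝒢.ρ v) j) ≫ (pt.ψ b v h).hom =
          ((K.obj j).ψ b v h).hom ≫ colimit.ι (K ⋙ 𝒢.ρE (𝒢.graph.edgeOf b)) j := by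
      intro b v h j
      have B1 : (𝒢.pull b v h).pullback.map (colimit.ι (K ⋙ 𝒢.ρ v) j) ≫ (pt.ψ b v h).hom =
          ((𝒢.pull b v h).pullback.map (colimit.ι (K ⋙ 𝒢.ρ v) j) ≫
            (preservesColimitIso (𝒢.pull b v h).pullback (K ⋙ 𝒢.ρ v)).hom) ≫
              (HasColimit.isoOfNatIso (ν b v h)).hom := (Category.assoc _ _ _).symm
      have B2 : (𝒢.pull b v h).pullback.map (colimit.ι (K ⋙ 𝒢.ρ v) j) ≫
          (preservesColimitIso (𝒢.pull b v h).pullback (K ⋙ 𝒢.ρ v)).hom =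
            colimit.ι ((K ⋙ 𝒢.ρ v) ⋙ (𝒢.pull b v h).pullback) j :=
        ι_preservesColimitIso_hom _ _ _
      have B3 : colimit.ι ((K ⋙ 𝒢.ρ v) ⋙ (𝒢.pull b v h).pullback) j ≫
          (HasColimit.isoOfNatIso (ν b v h)).hom =
            (ν b v h).hom.app j ≫ colimit.ι (K ⋙ 𝒢.ρE (𝒢.graph.edgeOf b)) j :=
        HasColimit.isoOfNatIso_ι_hom _ _
      exact B1.trans ((congrArg (· ≫ (HasColimit.isoOfNatIso (ν b v h)).hom) B2).trans B3)
    let c : Cocone K :=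
      { pt := pt
        ι :=
          { app := fun j =>
              { fS := fun v => colimit.ι (K ⋙ 𝒢.ρ v) j
                fT := fun e => colimit.ι (K ⋙ 𝒢.ρE e) j
                comm := fun b v h => hψ b v h j }
            naturality := fun j j' f => by
              refine BObj.hom_ext _ _ (funext fun v => ?_) (funext fun e => ?_)
              · show (K.map f).fS v ≫ colimit.ι (K ⋙ 𝒢.ρ v) j' = colimit.ι (K ⋙ 𝒢.ρ v) j ≫ 𝟙 _
                rw [Category.comp_id]
                exact colimit.w (K ⋙ 𝒢.ρ v) f
              · show (K.map f).fT e ≫ colimit.ι (K ⋙ 𝒢.ρE e) j' = colimit.ι (K ⋙ 𝒢.ρE e) j ≫ 𝟙 _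
                rw [Category.comp_id]
                exact colimit.w (K ⋙ 𝒢.ρE e) f } }
    have hc : IsColimit c :=
      { desc := fun s =>
          { fS := fun v => colimit.desc (K ⋙ 𝒢.ρ v) ((𝒢.ρ v).mapCocone s)
            fT := fun e => colimit.desc (K ⋙ 𝒢.ρE e) ((𝒢.ρE e).mapCocone s)
            comm := fun b v h => by
              apply (isColimitOfPreserves (𝒢.pull b v h).pullback
                (colimit.isColimit (K ⋙ 𝒢.ρ v))).hom_ext
              intro j
              rw [Functor.mapCocone_ι_app, colimit.cocone_ι]
              have A1 : (𝒢.pull b v h).pullback.map (colimit.ι (K ⋙ 𝒢.ρ v) j) ≫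
                  (𝒢.pull b v h).pullback.map
                    (colimit.desc (K ⋙ 𝒢.ρ v) ((𝒢.ρ v).mapCocone s)) ≫ (s.pt.ψ b v h).hom =
                  ((𝒢.pull b v h).pullback.map (colimit.ι (K ⋙ 𝒢.ρ v) j) ≫
                    (𝒢.pull b v h).pullback.map
                      (colimit.desc (K ⋙ 𝒢.ρ v) ((𝒢.ρ v).mapCocone s))) ≫ (s.pt.ψ b v h).hom :=
                (Category.assoc _ _ _).symm
              have A2 : (𝒢.pull b v h).pullback.map (colimit.ι (K ⋙ 𝒢.ρ v) j) ≫
                  (𝒢.pull b v h).pullback.map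
                    (colimit.desc (K ⋙ 𝒢.ρ v) ((𝒢.ρ v).mapCocone s)) =
                  (𝒢.pull b v h).pullback.map ((s.ι.app j).fS v) := by
                rw [← Functor.map_comp, colimit.ι_desc]
                rfl
              have A3 := (s.ι.app j).comm b v h
              have A4 : colimit.ι (K ⋙ 𝒢.ρE (𝒢.graph.edgeOf b)) j ≫
                  colimit.desc (K ⋙ 𝒢.ρE (𝒢.graph.edgeOf b))
                    ((𝒢.ρE (𝒢.graph.edgeOf b)).mapCocone s) = (s.ι.app j).fT (𝒢.graph.edgeOf b) :=
                colimit.ι_desc _ _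
              have A5 : ((𝒢.pull b v h).pullback.map (colimit.ι (K ⋙ 𝒢.ρ v) j) ≫
                  (pt.ψ b v h).hom) ≫ colimit.desc (K ⋙ 𝒢.ρE (𝒢.graph.edgeOf b))
                    ((𝒢.ρE (𝒢.graph.edgeOf b)).mapCocone s) =
                  ((K.obj j).ψ b v h).hom ≫ colimit.ι (K ⋙ 𝒢.ρE (𝒢.graph.edgeOf b)) j ≫
                    colimit.desc (K ⋙ 𝒢.ρE (𝒢.graph.edgeOf b))
                      ((𝒢.ρE (𝒢.graph.edgeOf b)).mapCocone s) :=
                (congrArg (· ≫ colimit.desc (K ⋙ 𝒢.ρE (𝒢.graph.edgeOf b))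
                  ((𝒢.ρE (𝒢.graph.edgeOf b)).mapCocone s)) (hψ b v h j)).trans
                    (Category.assoc _ _ _)
              exact A1.trans ((congrArg (· ≫ (s.pt.ψ b v h).hom) A2).trans (A3.trans
                ((congrArg (((K.obj j).ψ b v h).hom ≫ ·) A4).symm.trans
                  (A5.symm.trans (Category.assoc _ _ _))))) }
        fac := fun s j => by
          refine BObj.hom_ext _ _ (funext fun v => ?_) (funext fun e => ?_)
          · exact colimit.ι_desc _ _
          · exact colimit.ι_desc _ _
        uniq := fun s m hm => by
          refine BObj.hom_ext _ _ (funext fun v => ?_) (funext fun e => ?_)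
          · apply colimit.hom_ext
            intro j
            exact (congrArg (fun g => BObj.Hom.fS g v) (hm j)).trans
              (colimit.ι_desc ((𝒢.ρ v).mapCocone s) j).symm
          · apply colimit.hom_ext
            intro j
            exact (congrArg (fun g => BObj.Hom.fT g e) (hm j)).trans
              (colimit.ι_desc ((𝒢.ρE e).mapCocone s) j).symm }
    refine ⟨c, ⟨hc⟩, fun v => ⟨?_⟩, fun e => ⟨?_⟩⟩
    · exact (colimit.isColimit (K ⋙ 𝒢.ρ v)).ofIsoColimit
        (Cocone.ext (Iso.refl _) (fun j => Category.comp_id _))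
    · exact (colimit.isColimit (K ⋙ 𝒢.ρE e)).ofIsoColimit
        (Cocone.ext (Iso.refl _) (fun j => Category.comp_id _))
  refine ⟨⟨fun K => ?_⟩, fun v => ⟨fun {K} => ?_⟩, fun e => ⟨fun {K} => ?_⟩⟩
  · obtain ⟨c, ⟨hc⟩, -, -⟩ := main K
    exact ⟨c, hc⟩
  · obtain ⟨c, ⟨hc⟩, hv, -⟩ := main K
    exact preservesColimit_of_preserves_colimit_cocone hc (hv v).some
  · obtain ⟨c, ⟨hc⟩, -, he⟩ := main K
    exact preservesColimit_of_preserves_colimit_cocone hc (he e).some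

end SemiGraphOfAnabelioids

end Literature.AnabelianGeometry.SemiGraphs
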